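import Summits.AtomisticToContinuum.Crystallization.Theses.PalmUnimodularRigidity
import Summits.AtomisticToContinuum.Crystallization.Theorems.MinimiserShells.Negative.LoadBearing
import Summits.AtomisticToContinuum.Crystallization.Theorems.MinimiserShells.Negative.Rootedness
import Summits.AtomisticToContinuum.Crystallization.Theorems.PalmUnimodularRigidityMinimiserShellsEquilibriumInLawCluster
import Literature.Probability.Process.PointStationaryLaw
import Literature.MathematicalPhysics.StatisticalMechanics.MuGSC

/-!
# The no-boundary shell gap prices deep badly-shelled sites (stub `stub_deepBadPricing_of_shellNoBoundary`, S9)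

Stub S9 of line `equilibrium-in-law-surgery` (reshape r3) of crux `MinimiserShells`
(stmt-AtomisticToContinuum-9225, route `PalmUnimodularRigidity`).

If the particle-level NO-BOUNDARY shell gap holds — some `κ > 0` with
`N · e* + κ · #{badly-shelled sites of y} ≤ 𝓔_N(y)` for every finite injective configuration
`y : Fin N → ℝ³` — then deep badly-shelled sites of finite sub-windows are linearly priced (the
finite pricing statement S7′ of the line): for every `δ > 0` there are `R₀, c > 0` (here `R₀ = 2`,
`c = κ`) such that for every `δ`-separated `S ⊆ ℝ³`, every finite `C ⊆ S` and every `G ⊆ C` of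
sites `y` that are badly shelled in `S` (`¬ GoodShell (count|((· - y) '' S))`) and `R₀`-deep in `C`
(`S ∩ B̄(y, R₀) ⊆ C`), `#C · e* + c · #G ≤ ½ ∑_{x ∈ C} ∑_{z ∈ C} V_LJ(|x − z|)`.  The `μ`GSC
hypothesis of S7′ (and the separation) is not used: the statement holds for every `S`.

Proof.  `GoodShell μ` reads only which points of the closed ball `B̄(0, 5/4)` are atoms of `μ`
(`goodShell_congr_of_local`), so a site `y` with `S ∩ B̄(y, R₀) ⊆ C ⊆ S`, `R₀ ≥ 5/4`, is badly
shelled in `S` iff it is badly shelled in the finite configuration `C`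
(`goodShell_count_restrict_image_sub_congr`).  Enumerate `C` canonically by `Finset.equivFin`:
twice the interaction energy of the enumeration is the double sum over `C`
(`two_mul_interactionEnergy_equivFin` of `…EquilibriumInLaw.Cluster`), and `G` injects into the
badly-shelled indices of the enumeration (`card_le_natCard_bad`).
-/

noncomputable section

open MeasureTheory
open scoped ENNReal BigOperators Classical

namespace Summit.AtomisticToContinuum.Crystallization.Theorems.PalmUnimodularRigidityMinimiserShells.ShellNoBoundary

open Literature.Probability.Process (IsPointStationaryLaw IsRootedHardCore count_restrict_singleton_ne_zero_iff
  map_sub_count_restrict)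
open Literature.MathematicalPhysics.StatisticalMechanics (lennardJones IsMuGSC UniformlyDiscrete interactionEnergy)
open Summit.AtomisticToContinuum.Crystallization.Theses.PalmUnimodularRigidity (MinimiserShells UnimodularEnergyLowerBound)
open Summit.AtomisticToContinuum.Crystallization.Theorems.MinimiserShells.Negative.LoadBearing
  (eStar meanRootEnergy GoodShell minimiserShells_iff)
open Summit.AtomisticToContinuum.Crystallization.Theorems.MinimiserShells.Negative.Rootedness (E3)
open Summit.AtomisticToContinuum.Crystallization.Theorems.PalmUnimodularRigidityMinimiserShells.EquilibriumInLaw.Cluster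
  (two_mul_interactionEnergy_equivFin)

/-! ## Locality of the shell predicate -/

/-- One direction of `goodShell_congr_of_local`: if `μ` and `ν` have the same atoms in the closed
ball `B̄(0, 5/4)`, a good shell of `μ` is a good shell of `ν`. -/
theorem goodShell_of_local {μ ν : Measure E3}
    (h : ∀ w : E3, ‖w‖ ≤ 5 / 4 → (μ {w} ≠ 0 ↔ ν {w} ≠ 0)) (hμ : GoodShell μ) : GoodShell ν := by
  obtain ⟨a, ha₁, ha₂, T, hT, hclose⟩ := hμ
  refine ⟨a, ha₁, ha₂, T, ?_, hclose⟩
  rw [hT]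
  ext y
  simp only [Set.mem_setOf_eq]
  constructor
  · rintro ⟨hy, hy0, hle⟩
    exact ⟨(h y (by linarith)).1 hy, hy0, hle⟩
  · rintro ⟨hy, hy0, hle⟩
    exact ⟨(h y (by linarith)).2 hy, hy0, hle⟩

/-- **Locality of `GoodShell`.** The shell predicate reads only which points of the closed ball
`B̄(0, 5/4)` are atoms: if `μ {w} ≠ 0 ↔ ν {w} ≠ 0` for all `‖w‖ ≤ 5/4`, then
`GoodShell μ ↔ GoodShell ν`. -/
theorem goodShell_congr_of_local {μ ν : Measure E3}
    (h : ∀ w : E3, ‖w‖ ≤ 5 / 4 → (μ {w} ≠ 0 ↔ ν {w} ≠ 0)) : GoodShell μ ↔ GoodShell ν :=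
  ⟨goodShell_of_local h, goodShell_of_local fun w hw => (h w hw).symm⟩

/-- Atoms of a re-rooted counting measure: `count|((· - y) '' X) {w} ≠ 0 ↔ w + y ∈ X`. -/
theorem count_restrict_image_sub_singleton_ne_zero_iff (X : Set E3) (y w : E3) :
    (Measure.count : Measure E3).restrict ((fun z => z - y) '' X) {w} ≠ 0 ↔ w + y ∈ X := by
  rw [count_restrict_singleton_ne_zero_iff]
  simp only [Set.mem_image]
  constructor
  · rintro ⟨z, hz, rfl⟩
    rwa [sub_add_cancel]
  · exact fun hw => ⟨w + y, hw, add_sub_cancel_right w y⟩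

/-- **Deep sites see the same shell in `S` and in the window.** If `C ⊆ S` contains every point of
`S` within distance `R₀ ≥ 5/4` of `y`, then `y` is well shelled in `S` iff it is well shelled in
`C` (re-rooted counting measures `count|((· - y) '' ·)`). -/
theorem goodShell_count_restrict_image_sub_congr {S C : Set E3} (hCS : C ⊆ S) {y : E3} {R₀ : ℝ}
    (hR₀ : 5 / 4 ≤ R₀) (hdeep : S ∩ Metric.closedBall y R₀ ⊆ C) :
    GoodShell ((Measure.count : Measure E3).restrict ((fun z => z - y) '' S)) ↔
      GoodShell ((Measure.count : Measure E3).restrict ((fun z => z - y) '' C)) := by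
  refine goodShell_congr_of_local fun w hw => ?_
  rw [count_restrict_image_sub_singleton_ne_zero_iff, count_restrict_image_sub_singleton_ne_zero_iff]
  refine ⟨fun hS => hdeep ⟨hS, ?_⟩, fun hC => hCS hC⟩
  rw [Metric.mem_closedBall, dist_eq_norm, add_sub_cancel_right]
  exact hw.trans hR₀

/-! ## Enumerations and badly-shelled indices -/

/-- The canonical enumeration of a Finset is injective. -/
theorem equivFin_symm_val_injective (C : Finset E3) :
    Function.Injective (fun i => ((C.equivFin.symm i : C) : E3)) :=
  fun _ _ h => C.equivFin.symm.injective (Subtype.val_injective h)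

/-- The canonical enumeration of a Finset `C` has range `↑C`. -/
theorem range_equivFin_symm_val (C : Finset E3) :
    Set.range (fun i => ((C.equivFin.symm i : C) : E3)) = ↑C := by
  ext x
  constructor
  · rintro ⟨i, rfl⟩
    exact (C.equivFin.symm i).2
  · intro hx
    exact ⟨C.equivFin ⟨x, hx⟩, by simp only [Equiv.symm_apply_apply]⟩

/-- **Deep bad sites inject into the badly-shelled indices of an enumeration.** If `y : Fin N → ℝ³`
has range `C ⊆ S` and every site of `G ⊆ C` is badly shelled in `S` and `R₀`-deep in `C`
(`R₀ ≥ 5/4`), then `#G` is at most the number of indices `i` that are badly shelled in the finite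
configuration `y` (re-rooted at `y i`). -/
theorem card_le_natCard_bad {S : Set E3} {C G : Finset E3} (hCS : ↑C ⊆ S) {R₀ : ℝ}
    (hR₀ : 5 / 4 ≤ R₀) (hGC : G ⊆ C)
    (hG : ∀ y ∈ G, ¬ GoodShell ((Measure.count : Measure E3).restrict ((fun z => z - y) '' S)) ∧
      S ∩ Metric.closedBall y R₀ ⊆ ↑C)
    {N : ℕ} {y : Fin N → E3} (hrange : Set.range y = ↑C) :
    G.card ≤ Nat.card {i : Fin N // ¬ GoodShell
      ((Measure.count : Measure E3).restrict ((fun z => z - y i) '' Set.range y))} := by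
  have hmem : ∀ g : G, ∃ i : Fin N, y i = (g : E3) := fun g =>
    Set.mem_range.1 (by rw [hrange]; exact Finset.mem_coe.2 (hGC g.2))
  choose idx hidx using hmem
  have hbad : ∀ g : G, ¬ GoodShell
      ((Measure.count : Measure E3).restrict ((fun z => z - y (idx g)) '' Set.range y)) := by
    intro g
    rw [hidx g, hrange]
    exact fun hgood =>
      (hG g g.2).1 ((goodShell_count_restrict_image_sub_congr hCS hR₀ (hG g g.2).2).2 hgood)
  rw [← Nat.card_eq_finsetCard G]
  refine Nat.card_le_card_of_injective (fun g : G => (⟨idx g, hbad g⟩ : {i : Fin N // ¬ GoodShell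
      ((Measure.count : Measure E3).restrict ((fun z => z - y i) '' Set.range y))})) ?_
  intro g g' h
  have hi : idx g = idx g' := congrArg Subtype.val h
  exact Subtype.ext (calc (g : E3) = y (idx g) := (hidx g).symm
    _ = y (idx g') := by rw [hi]
    _ = g' := hidx g')

/-! ## The stub -/

/-- **Stub `stub_deepBadPricing_of_shellNoBoundary` (S9) of line `equilibrium-in-law-surgery`.**  The
particle-level no-boundary shell gap `N · e* + κ · #bad(y) ≤ 𝓔_N(y)` (all finite injective `y`)
implies the finite deep-bad pricing S7′ with `R₀ = 2`, `c = κ`, for every `S ⊆ ℝ³` (the separation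
and `μ`GSC hypotheses are not used): enumerate the window `C` canonically, compare `½ ∑∑_C V_LJ`
with `𝓔_{#C}` (`two_mul_interactionEnergy_equivFin`) and inject the deep bad sites `G` into the
badly-shelled indices (`card_le_natCard_bad`, locality of `GoodShell`). -/
theorem stub_deepBadPricing_of_shellNoBoundary :
    (∃ κ : ℝ, 0 < κ ∧ ∀ (N : ℕ) (y : Fin N → EuclideanSpace ℝ (Fin 3)), Function.Injective y →
      (N : ℝ) * eStar + κ * (Nat.card {i : Fin N // ¬ GoodShell
          ((Measure.count : Measure (EuclideanSpace ℝ (Fin 3))).restrict ((fun z => z - y i) '' Set.range y))} : ℝ) ≤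
        interactionEnergy lennardJones y) →
    ∀ δ : ℝ, 0 < δ → ∃ R₀ c : ℝ, 0 < R₀ ∧ 0 < c ∧
      ∀ S : Set (EuclideanSpace ℝ (Fin 3)), (∀ x ∈ S, ∀ z ∈ S, x ≠ z → δ ≤ dist x z) →
        IsMuGSC lennardJones eStar S →
        ∀ C : Finset (EuclideanSpace ℝ (Fin 3)), (↑C : Set (EuclideanSpace ℝ (Fin 3))) ⊆ S →
        ∀ G : Finset (EuclideanSpace ℝ (Fin 3)), G ⊆ C →
          (∀ y ∈ G, ¬ GoodShell ((Measure.count : Measure (EuclideanSpace ℝ (Fin 3))).restrict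
              ((fun z => z - y) '' S)) ∧ S ∩ Metric.closedBall y R₀ ⊆ ↑C) →
          (C.card : ℝ) * eStar + c * G.card ≤ (∑ x ∈ C, ∑ z ∈ C, lennardJones (dist x z)) / 2 := by
  rintro ⟨κ, hκ, hgap⟩ δ _
  refine ⟨2, κ, two_pos, hκ, fun S _ _ C hCS G hGC hG => ?_⟩
  have hE := hgap C.card (fun i => ((C.equivFin.symm i : C) : E3)) (equivFin_symm_val_injective C)
  have h2 := two_mul_interactionEnergy_equivFin C
  have hle : (G.card : ℝ) ≤ (Nat.card {i : Fin C.card // ¬ GoodShell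
      ((Measure.count : Measure E3).restrict ((fun z => z - ((C.equivFin.symm i : C) : E3)) ''
        Set.range (fun i => ((C.equivFin.symm i : C) : E3))))} : ℝ) := by
    exact_mod_cast card_le_natCard_bad hCS (by norm_num : (5 : ℝ) / 4 ≤ 2) hGC hG
      (range_equivFin_symm_val C)
  have hmul := mul_le_mul_of_nonneg_left hle hκ.le
  linarith

end Summit.AtomisticToContinuum.Crystallization.Theorems.PalmUnimodularRigidityMinimiserShells.ShellNoBoundary

end
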